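import Summits.AtomisticToContinuum.Crystallization.Theses.ReggeStarCoercivity
import Literature.MathematicalPhysics.StatisticalMechanics.Yuhjtman2015Stability
import Literature.MathematicalPhysics.StatisticalMechanics.Yuhjtman2015Proofs
import Literature.MathematicalPhysics.StatisticalMechanics.LennardJonesThermodynamicLimitProofs
import Literature.MathematicalPhysics.StatisticalMechanics.LennardJonesClusters

/-!
# Disproof of `StabilityConstantTwelve` — findings (cdisprove gen 2; supersedes gen 1's file,
whose certified content is re-proved here: gen-1's evidence files are not readable from the hub)

Crux `stmt-AtomisticToContinuum-13601` (route `ReggeStarCoercivity`, rank 3):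

  `StabilityConstantTwelve : ∀ N : ℕ, -(N : ℝ) ≤ groundStateEnergy lennardJones 3 N`

i.e. the Lennard-Jones stability constant in `ℝ³` is at most `12 ε` (Blanc–Lewin units
`V = r⁻¹²/12 - r⁻⁶/6`, `min V = -1/12`; `E(N)` = infimum over INJECTIVE configurations; no junk:
the index type is non-empty and energies are bounded below, so `⨅` is the true infimum).

VERDICT: RESISTS DISPROOF (all statements below are sorry-free unless marked NEAR-MISS).
* §0 `stabilityConstantTwelve_iff_einf`: by Fekete (`BlancLewin2015_8_holds`) the crux is
  EQUIVALENT to `e_∞ ≥ -1` (`e_∞ = lim E(N)/N = inf E(N)/N`). Every numerical datum gives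
  `e_∞ ≈ e(hcp) ≈ -0.7175 = -8.61 ε/12` (margin `0.28`); a counterexample is ONE finite cluster
  with `E < -N`, i.e. `40 %` below the fcc/hcp energy density — excluded by every cluster table
  (Cambridge Cluster Database: `E(N)/N ≥ -0.50` for `N ≤ 150`; fcc balls: `-0.56` at `N = 555`,
  §4) unless the crystallization picture itself is wrong by 40 %.
* §1 certified window: `-(14.316/12) N ≤ E(N)` (Yuhjtman 2015 Thm 9, PROVED in the tree) vs the
  crux's `-N`: the open gap is the factor `1.193 → 1`. For `N ≤ 25` the crux is TRIVIAL (pair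
  count); all content is asymptotic.

LOAD-BEARING ANALYSIS ("Without H" is FALSE ⇒ every proof must use H):
* §2 injectivity: `stabilityConstantTwelve_false_without_injective` (`N = 49`, piles 24 + 25 at
  distance 1, energy `-50`; junk `V_LJ(0) = 0`).
* §3 dimension three: the `ℝᵈ` analogue is FALSE for EVERY `d ≥ 4` — certified here for `d = 5`
  (`not_stability_dim5`: the 131-point `D₅` ball, `E ≤ -140 < -131`), `d = 6`
  (`not_stability_dim6`: `D₆` roots + origin, 61 points, `E ≤ -63`), `d ≥ 26` (simplex); for
  `d = 4` (`D₄` ball of 409 points, `E ≤ -420`, THE threshold case) and `d = 8` see the companions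
  `DisproofHeavyD4.lean` / `DisproofHeavy.lean` (crux dir + item evidence); by zero-padding
  (`groundStateEnergy_mono_dim`, §3c) the analogue is false for EVERY `d ≥ 4`
  (`not_stability_dim_ge_five` here, `not_stability_dim_ge_four` in the D4 companion). Lattice sums: `e(D₄) ≈ -2.15`,
  `e(D₅) ≈ -9.8`, `d ≥ 6` not even stable (`r⁻⁶` tail not integrable); `e(fcc) = -0.7175`,
  `e(tri, d=2) = -0.317`. So `d = 3` is the LAST dimension in which `B ≤ 12ε` can hold and the
  margin `0.28` is what three-dimensional packing constraints buy over four-dimensional ones.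

TIGHTNESS (§4): the constant `1` cannot go below `≈ 0.7175`; certified anchors
`E(13) ≤ -27/8` (`c ≥ 0.2596`), `E(55) ≤ -22.3` (`c ≥ 0.4054`), companion `E(201) ≤ -102.5`
(`c ≥ 0.51`); conditional `c ≥ -e(P)` for any periodic `P` once `CrysEnergyUpper` (item 11865)
is proved (`tight_of_crysEnergyUpper`).

PROVER-FACING OBSTRUCTIONS (§5, §6) — the two "cheap" strategies are dead under separation-only
hypotheses (Yuhjtman Cor. 7, `d_min > 0.684`, is the only local structure PROVED for ground states):
* §5 ONE-CENTRE: a sitewise bound "site energy `≥ -2`" would give the crux by double counting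
  (`stabilityConstantTwelve_of_sitewise`, certified) but is FALSE even for `0.744`-separated
  configurations: `not_sitewiseTwelve_0744` / `_0684` (certified hedgehog: snub cube + 14 outer
  points, centre site energy `-2.161`); fcc bulk site `-1.4344` (margin `28 %`). A kit job
  (j006695, compute/hedgehog) tabulates hedgehog optima vs `δ ∈ [0.684, 1]` (queued at writing).
* §6 INDUCTION BY REMOVAL: `stabilityConstantTwelve_of_exists_weak_site` (certified reduction):
  the crux follows if every ground state has SOME particle with site energy `≥ -1`. True in
  nature (vertex atoms `≈ -0.6`) but the only shape-free way to locate a weak particle — an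
  extreme point, all neighbours in a half-space — has NO slack: the fcc `(111)` / hcp `(0001)`
  face atom at bulk spacing `0.9712` has half-space site energy `-0.9946` (margin `0.5 %`), and
  at separation `0.685` the half-space hedgehog `not_extremeSiteBound_0685` / `_0684` (certified,
  28 neighbours, site energy `-1.361`) violates it; §6b certifies the `< 1 %` slack at the TRUE
  separation (`fcc111_face_certificate`: 429-atom fcc piece, `0.9715`-separated, face site `< -0.99`).
  ⇒ do not plan on extreme-point induction; multi-centre / transfer (star, LP) information or a
  genuinely global argument is required — consistent with the route's Delaunay-star design.

LITERATURE (2026-08-16; `lit citing arxiv:1501.05248`, searchd down): the record is STILL `B ≤ 14.316 ε`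
— Kuznetsov–Sahinidis, J. Global Optim. (2025) doi:10.1007/s10898-025-01476-7, p. 17: "the stability
constant of the Lennard–Jones potential … the best known value is currently −14.316 [Yuhjtman]"; they
add the aggregation bound `E(N)/N ≥ (N-1) E(M)/(M(M-1))` from a certified `E(6)` (BARON, 31.7 h), which
would push the trivial range of §1 from `N ≤ 25` to `N ≤ 29` only. Kiessling–Wales(?), Molecular Physics
(2025) arXiv:2511.15008: best PROVED minimal distance in global minima is Yuhjtman's `0.684` (their
`0.767764 × 2^{-1/6}`); they CONJECTURE `d_min > 2^{-1/6} = 0.8909` (every pair attractive) and report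
`d_min ≈ 0.903` numerically (`N = 923`). Consequence for §5: the sitewise strategy is dead at every
separation one can currently prove (`≤ 0.744` certified here), but `KW conjecture + SitewiseTwelve 0.8909`
would give the crux (`stabilityConstantTwelve_of_KW`), and at `δ = 0.8909` hedgehogs are estimated to
reach only `B ≈ 19–20 < 24` bonds (15 spikes by Tammes + outer shells; kit j007594 will confirm).
Hoy, PRE 109 (2024) 044604 (arXiv:2311.03465) p. 1: in `d = 4` the local optimum (24-cell) is
compatible with `D₄` — no frustration, kissing 24 — matching the certified failure of the `ℝ⁴` analogue.

Targets (lead's stuck stubs): none filed (payload.stuck_stubs = []).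
-/

noncomputable section

namespace Summit.AtomisticToContinuum.Crystallization.Cruxes.StabilityConstantTwelve.Disproof

open Literature.MathematicalPhysics.StatisticalMechanics
open Summit.AtomisticToContinuum.Crystallization.Theses.ReggeStarCoercivity
  (StabilityConstantTwelve CrysEnergyUpper)
open Filter Topology

/-! ## §0 Equivalent forms of the crux -/

/-- Configuration form: the crux is the statement `∑_{i<j} V_LJ(|xᵢ-xⱼ|) ≥ -N` for every
INJECTIVE configuration of `N` points of `ℝ³` (the infimum defining `E(N)` is over a non-empty
family and is attained from above by every member). -/
theorem stabilityConstantTwelve_iff_config :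
    StabilityConstantTwelve ↔ ∀ (N : ℕ) (x : Fin N → EuclideanSpace ℝ (Fin 3)),
      Function.Injective x → -(N : ℝ) ≤ interactionEnergy lennardJones x := by
  constructor
  · intro h N x hx
    exact (h N).trans (groundStateEnergy_lennardJones_le hx)
  · intro h N
    haveI := nonempty_injective_config (d := 3) (by norm_num) N
    exact le_ciInf fun x => h N x.1 x.2

/-- Thermodynamic form: the crux is EQUIVALENT to `e_∞ ≥ -1` for the limit
`e_∞ = lim E(N)/N` (which exists and equals `inf_{N ≥ 1} E(N)/N`, `BlancLewin2015_8_holds`).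
Hence a disproof must exhibit ONE finite cluster with `E < -N`, and a proof may work at
`N → ∞` only. -/
theorem stabilityConstantTwelve_iff_einf :
    StabilityConstantTwelve ↔ ∀ e : ℝ,
      Tendsto (fun N : ℕ => groundStateEnergy lennardJones 3 N / N) atTop (𝓝 e) → -1 ≤ e := by
  constructor
  · intro h e he
    refine ge_of_tendsto he ?_
    filter_upwards [eventually_gt_atTop 0] with N hN
    have hN' : (0 : ℝ) < N := by exact_mod_cast hN
    rw [le_div_iff₀ hN']
    have := h N
    linarith
  · intro h N
    obtain ⟨e, _, htend, hinf⟩ := BlancLewin2015_8_holds 3 (by norm_num) (by norm_num)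
    have he := h e htend
    rcases Nat.eq_zero_or_pos N with rfl | hN
    · simp [groundStateEnergy_of_le_one lennardJones (zero_le_one)]
    · have hN' : (0 : ℝ) < N := by exact_mod_cast hN
      have h1 := hinf N hN
      rw [le_div_iff₀ hN'] at h1
      nlinarith

/-! ## §1 What is certified already: the window `[-1.193 N, ?]` and the trivial range `N ≤ 25` -/

/-- Yuhjtman 2015, Thm 9, PROVED in the tree (`Yuhjtman2015_stabilityConstant_holds`):
`E(N) ≥ -(14.316/12) N ≈ -1.193 N`. The crux asks for `-1 · N`. -/
theorem known_lower_bound (N : ℕ) :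
    -(14.316 / 12 * (N : ℝ)) ≤ groundStateEnergy lennardJones 3 N :=
  Yuhjtman2015_stabilityConstant_holds.groundStateEnergy_ge N

/-- Pair counting: every configuration of `N` points (injective or not, any dimension) has
`𝓔_N ≥ -N(N-1)/24`, since each of the `N(N-1)/2` pairs contributes `≥ min V_LJ = -1/12`. -/
theorem interactionEnergy_ge_pairs {d N : ℕ} (x : Fin N → EuclideanSpace ℝ (Fin d)) :
    -((N : ℝ) * (N - 1) / 24) ≤ interactionEnergy lennardJones x := by
  have h2 := two_mul_interactionEnergy lennardJones x
  have hsite : ∀ i, -((N - 1 : ℝ) / 12) ≤ siteEnergy lennardJones x i := fun i => by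
    unfold siteEnergy
    have hN : 1 ≤ N := i.pos
    have hc : ((Finset.univ.erase i).card : ℝ) = N - 1 := by
      rw [Finset.card_erase_of_mem (Finset.mem_univ i), Finset.card_univ, Fintype.card_fin,
        Nat.cast_sub hN, Nat.cast_one]
    calc -((N - 1 : ℝ) / 12) = ∑ _k ∈ Finset.univ.erase i, (-1 / 12 : ℝ) := by
          rw [Finset.sum_const, nsmul_eq_mul, hc]; ring
      _ ≤ _ := Finset.sum_le_sum fun k _ => neg_one_div_le_lennardJones _
  have := Finset.sum_le_sum fun i (_ : i ∈ Finset.univ) => hsite i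
  rw [Finset.sum_const, Finset.card_univ, Fintype.card_fin, nsmul_eq_mul] at this
  linarith

/-- Hence `E(N) ≥ -N(N-1)/24` in `ℝ³`. -/
theorem pair_lower_bound (N : ℕ) :
    -((N : ℝ) * (N - 1) / 24) ≤ groundStateEnergy lennardJones 3 N := by
  haveI := nonempty_injective_config (d := 3) (by norm_num) N
  exact le_ciInf fun x => interactionEnergy_ge_pairs x.1

/-- TRIVIAL RANGE: the crux holds for `N ≤ 25` by pair counting alone (`N(N-1)/24 ≤ N` iff
`N ≤ 25`). Positive evidence, not landable by the refuter; the first case with content is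
`N = 26`. -/
theorem stabilityConstantTwelve_upTo25 {N : ℕ} (hN : N ≤ 25) :
    -(N : ℝ) ≤ groundStateEnergy lennardJones 3 N := by
  refine le_trans ?_ (pair_lower_bound N)
  have h25 : (N : ℝ) ≤ 25 := by exact_mod_cast hN
  have h0 : (0 : ℝ) ≤ N := N.cast_nonneg
  nlinarith

/-! ## §2 Load-bearing hypothesis: injectivity (distinct points) -/

/-- The crux with injectivity DROPPED: all configurations `x : Fin N → ℝ³`, coincidences allowed
(then `V_LJ(0) = 0` by `0⁻¹ = 0`). -/
def StabilityConstantTwelveWithoutInjective : Prop :=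
  ∀ (N : ℕ) (x : Fin N → EuclideanSpace ℝ (Fin 3)), -(N : ℝ) ≤ interactionEnergy lennardJones x

/-- A constant configuration has zero Lennard-Jones energy (`V_LJ(0) = 0`). -/
theorem interactionEnergy_const {d M : ℕ} (c : EuclideanSpace ℝ (Fin d)) :
    interactionEnergy lennardJones (fun _ : Fin M => c) = 0 := by
  simp [interactionEnergy, lennardJones_zero]

/-- ANY PROOF MUST USE INJECTIVITY: `24` particles at `0` and `25` at `e₀`, `|e₀| = 1`, have
energy `24 · 25 · V_LJ(1) = -50 < -49`. (Smallest such `N` is `49`: `⌊N/2⌋⌈N/2⌉/12 > N` iff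
`N ≥ 49`.) -/
theorem stabilityConstantTwelve_false_without_injective :
    ¬ StabilityConstantTwelveWithoutInjective := by
  intro h
  set e₀ : EuclideanSpace ℝ (Fin 3) := EuclideanSpace.single 0 1 with he₀
  have key := h (24 + 25) (Fin.append (fun _ : Fin 24 => (0 : EuclideanSpace ℝ (Fin 3)))
    (fun _ : Fin 25 => e₀))
  rw [interactionEnergy_append lennardJones lennardJones_zero, interactionEnergy_const,
    interactionEnergy_const] at key
  have hd : dist (0 : EuclideanSpace ℝ (Fin 3)) e₀ = 1 := by
    rw [dist_comm, dist_zero_right, he₀, PiLp.norm_single, norm_one]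
  simp only [hd, lennardJones_one, Finset.sum_const, Finset.card_univ, Fintype.card_fin,
    nsmul_eq_mul] at key
  norm_num at key

/-! ## §3 Load-bearing hypothesis: dimension three -/

/-- The crux with `ℝ³` replaced by `ℝᵈ` for every `d`. -/
def StabilityConstantTwelveWithoutDimThree : Prop :=
  ∀ (d N : ℕ), -(N : ℝ) ≤ groundStateEnergy lennardJones d N

/-- The vertices `eᵢ/√2` of the regular unit simplex in `ℝⁿ`. -/
def simplexConfig (n : ℕ) : Fin n → EuclideanSpace ℝ (Fin n) :=
  fun i => EuclideanSpace.single i (Real.sqrt 2)⁻¹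

theorem simplexConfig_injective (n : ℕ) : Function.Injective (simplexConfig n) := by
  intro i j hij
  by_contra hne
  have h := congrArg (fun v : EuclideanSpace ℝ (Fin n) => v i) hij
  simp [simplexConfig, hne] at h

theorem dist_simplexConfig {n : ℕ} {i j : Fin n} (hij : i ≠ j) :
    dist (simplexConfig n i) (simplexConfig n j) = 1 := by
  have hsq : dist (simplexConfig n i) (simplexConfig n j) ^ 2 = 1 := by
    rw [dist_eq_norm, norm_sub_sq_real]
    simp only [simplexConfig, PiLp.norm_single, EuclideanSpace.inner_single_left,
      PiLp.single_apply, hij, if_false, mul_zero]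
    rw [Real.norm_eq_abs, sq_abs, inv_pow, Real.sq_sqrt (by norm_num : (0:ℝ) ≤ 2)]
    norm_num
  have h0 : 0 ≤ dist (simplexConfig n i) (simplexConfig n j) := dist_nonneg
  nlinarith [hsq]

/-- The regular unit simplex on `n` vertices has energy exactly `-n(n-1)/24` (all `n(n-1)/2`
pairs at the potential minimum): the pair bound of §1 is attained in dimension `n`. -/
theorem interactionEnergy_simplexConfig (n : ℕ) :
    interactionEnergy lennardJones (simplexConfig n) = -((n : ℝ) * (n - 1) / 24) := by
  have h2 := two_mul_interactionEnergy lennardJones (simplexConfig n)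
  have hsite : ∀ i, siteEnergy lennardJones (simplexConfig n) i = -((n - 1 : ℝ) / 12) := fun i => by
    unfold siteEnergy
    have hN : 1 ≤ n := i.pos
    have hc : ((Finset.univ.erase i).card : ℝ) = n - 1 := by
      rw [Finset.card_erase_of_mem (Finset.mem_univ i), Finset.card_univ, Fintype.card_fin,
        Nat.cast_sub hN, Nat.cast_one]
    rw [Finset.sum_congr rfl fun k hk => by rw [dist_simplexConfig (Finset.ne_of_mem_erase hk).symm, lennardJones_one]]
    rw [Finset.sum_const, nsmul_eq_mul, hc]; ring
  have hs := Finset.sum_congr rfl fun i (_ : i ∈ (Finset.univ : Finset (Fin n))) => hsite i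
  rw [hs, Finset.sum_const, Finset.card_univ, Fintype.card_fin, nsmul_eq_mul] at h2
  linarith

/-- ANY PROOF MUST USE `d = 3`: in `ℝ²⁶` the `26`-point simplex has energy `-325/12 < -26`, so
the `ℝᵈ`-analogue of the crux fails (for every `d ≥ 26` by the same witness; numerically already
for `d ≥ 6` via the `E₆` root shell and for bulk `D₄`, `D₅` — uncertified). -/
theorem stabilityConstantTwelve_false_without_dim_three :
    ¬ StabilityConstantTwelveWithoutDimThree := by
  intro h
  have h1 := h 26 26
  have h2 : groundStateEnergy lennardJones 26 26 ≤ interactionEnergy lennardJones (simplexConfig 26) :=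
    groundStateEnergy_lennardJones_le (simplexConfig_injective 26)
  rw [interactionEnergy_simplexConfig] at h2
  norm_num at h1 h2
  linarith


/-! ### §3b A certified evaluation machine (natural-number rows at scale `√s`) and the `d = 5, 6` witnesses -/

namespace Cert

/-! Certified evaluation machine, version 2 (natural-number rows, one-pass distance histogram):
a configuration is given by rows `L : List (List ℕ)` (coordinates, any common translate) and a
rational scale `s`; its points are `√s · L[i]`, and `2 E = hsum L s ∈ ℚ` exactly, decided by the
kernel (`decide +kernel`; `Nat` arithmetic is GMP-accelerated there, hence `ℕ` rows). -/

/-- `(a - b)²` computed inside `ℕ` (no truncation: `2ab ≤ a² + b²`). -/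
def sqDiffN (a b : ℕ) : ℕ := a * a + b * b - 2 * a * b

/-- squared distance of two rows. -/
def sqDistN : List ℕ → List ℕ → ℕ
  | a :: u, b :: v => sqDiffN a b + sqDistN u v
  | _, _ => 0

/-- `V_LJ` as a function of the SQUARED distance, over `ℚ` and over `ℝ`. -/
def Wq (q : ℚ) : ℚ := (1 / 12) * (q⁻¹) ^ 6 - (1 / 6) * (q⁻¹) ^ 3
def W (q : ℝ) : ℝ := (1 / 12) * (q⁻¹) ^ 6 - (1 / 6) * (q⁻¹) ^ 3

/-- twice the energy as the plain double sum (specification). -/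
def dsum (L : List (List ℕ)) (s : ℚ) : ℚ :=
  (L.map fun u => (L.map fun v => Wq (s * sqDistN u v)).sum).sum

/-- histogram update (association list `squared distance ↦ count`). -/
def incr : List (ℕ × ℕ) → ℕ → List (ℕ × ℕ)
  | [], m => [(m, 1)]
  | (m', c) :: t, m => if m' = m then (m', c + 1) :: t else (m', c) :: incr t m

/-- histogram of the squared distances from the row `u` to all rows of `L` (one row at a time:
this bounds the depth of unevaluated accumulators in the kernel by `|L|`). -/
def rowHist (L : List (List ℕ)) (u : List ℕ) : List (ℕ × ℕ) :=
  L.foldl (fun acc v => incr acc (sqDistN u v)) []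

/-- twice the energy, evaluated row by row through histograms (what the kernel computes). -/
def hsum (L : List (List ℕ)) (s : ℚ) : ℚ :=
  (L.map fun u => ((rowHist L u).map fun p => (p.2 : ℚ) * Wq (s * p.1)).sum).sum

/-- all rows of length `d` with entries in `[0, 2r]`. -/
def boxVecs : ℕ → ℕ → List (List ℕ)
  | 0, _ => [[]]
  | d + 1, r => (boxVecs d r).flatMap fun v => (List.range (2 * r + 1)).map fun k => k :: v

/-- squared norm of the centred row `v - (r,…,r)`. -/
def normSqC (r : ℕ) (v : List ℕ) : ℕ := (v.map fun a => sqDiffN a r).sum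

/-- the `Dₙ`-type ball, translated by `(r,…,r)`: rows `v ∈ [0,2r]ᵈ` with `∑ (vᵢ - r)` even and
`|v - (r,…,r)|² ≤ R2` (`d = 3`: fcc balls; centre included). -/
def dBall (d r R2 : ℕ) : List (List ℕ) :=
  (boxVecs d r).filter fun v => decide ((v.sum + d * r) % 2 = 0 ∧ normSqC r v ≤ R2)

/-- the real configuration with coordinates `√s · L[i][k]`. -/
def config (d : ℕ) (s : ℚ) (L : List (List ℕ)) : Fin L.length → EuclideanSpace ℝ (Fin d) :=
  fun i => WithLp.toLp 2 fun k : Fin d => Real.sqrt s * (((L.get i).getD (k : ℕ) 0 : ℕ) : ℝ)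

theorem cast_sqDiffN (a b : ℕ) : ((sqDiffN a b : ℕ) : ℝ) = ((a : ℝ) - b) ^ 2 := by
  unfold sqDiffN
  have h : 2 * a * b ≤ a * a + b * b := by nlinarith [sq_nonneg ((a : ℤ) - b)]
  rw [Nat.cast_sub h]
  push_cast
  ring

theorem lennardJones_eq_W (r : ℝ) : lennardJones r = W (r ^ 2) := by
  simp only [lennardJones, W, inv_pow, ← pow_mul]

theorem W_cast (q : ℚ) : W (q : ℝ) = (Wq q : ℝ) := by
  simp only [W, Wq]; push_cast; ring

theorem sum_sq_getD : ∀ (d : ℕ) (u v : List ℕ), u.length = d → v.length = d →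
    ∑ k : Fin d, (((u.getD (k : ℕ) 0 : ℕ) : ℝ) - ((v.getD (k : ℕ) 0 : ℕ) : ℝ)) ^ 2 = (sqDistN u v : ℝ)
  | 0, [], [], _, _ => by simp [sqDistN]
  | d + 1, a :: u, b :: v, hu, hv => by
    rw [Fin.sum_univ_succ]
    simp only [Fin.val_zero, List.getD_cons_zero, Fin.val_succ, List.getD_cons_succ, sqDistN,
      Nat.cast_add, cast_sqDiffN]
    rw [sum_sq_getD d u v (by simpa using hu) (by simpa using hv)]
  | 0, _ :: _, _, hu, _ => by simp at hu
  | 0, [], _ :: _, _, hv => by simp at hv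
  | _ + 1, [], _, hu, _ => by simp at hu
  | _ + 1, _ :: _, [], _, hv => by simp at hv

theorem dist_sq_config {d : ℕ} {s : ℚ} (hs : 0 ≤ s) {L : List (List ℕ)}
    (hL : ∀ r ∈ L, r.length = d) (i j : Fin L.length) :
    dist (config d s L i) (config d s L j) ^ 2 = (s : ℝ) * (sqDistN (L.get i) (L.get j) : ℝ) := by
  rw [EuclideanSpace.dist_eq, Real.sq_sqrt (Finset.sum_nonneg fun _ _ => sq_nonneg _)]
  have hi := hL _ (List.get_mem L i)
  have hj := hL _ (List.get_mem L j)
  rw [← sum_sq_getD d _ _ hi hj, Finset.mul_sum]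
  refine Finset.sum_congr rfl fun k _ => ?_
  simp only [config, PiLp.toLp_apply, dist_eq_norm, Real.norm_eq_abs, sq_abs]
  rw [← mul_sub, mul_pow, Real.sq_sqrt (by exact_mod_cast hs)]

theorem lennardJones_dist_config {d : ℕ} {s : ℚ} (hs : 0 ≤ s) {L : List (List ℕ)}
    (hL : ∀ r ∈ L, r.length = d) (i j : Fin L.length) :
    lennardJones (dist (config d s L i) (config d s L j)) =
      (Wq (s * sqDistN (L.get i) (L.get j)) : ℝ) := by
  rw [lennardJones_eq_W, dist_sq_config hs hL, ← W_cast]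
  push_cast; rfl

theorem sum_fin_get {α β : Type*} [AddCommMonoid β] (L : List α) (g : α → β) :
    ∑ i : Fin L.length, g (L.get i) = (L.map g).sum := by
  rw [← List.sum_ofFn, ← List.ofFn_getElem_eq_map]
  rfl

/-- `2 E(config) = dsum L s`. -/
theorem two_mul_interactionEnergy_config {d : ℕ} {s : ℚ} (hs : 0 ≤ s) {L : List (List ℕ)}
    (hL : ∀ r ∈ L, r.length = d) :
    2 * interactionEnergy lennardJones (config d s L) = (dsum L s : ℝ) := by
  rw [two_mul_interactionEnergy_eq_sum_sum lennardJones lennardJones_zero]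
  simp_rw [lennardJones_dist_config hs hL]
  have h : ∀ i : Fin L.length, ∑ k : Fin L.length, ((Wq (s * sqDistN (L.get i) (L.get k)) : ℚ) : ℝ)
      = (((L.map fun v => Wq (s * sqDistN (L.get i) v)).sum : ℚ) : ℝ) := fun i => by
    rw [← sum_fin_get L (fun v => Wq (s * sqDistN (L.get i) v))]
    push_cast
    rfl
  simp_rw [h]
  rw [dsum, ← sum_fin_get L (fun u => (L.map fun v => Wq (s * sqDistN u v)).sum)]
  push_cast
  rfl

/-! #### correctness of the histogram evaluation: `hsum = dsum` -/

theorem sum_map_incr (s : ℚ) (acc : List (ℕ × ℕ)) (m : ℕ) :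
    ((incr acc m).map fun p => (p.2 : ℚ) * Wq (s * p.1)).sum =
      (acc.map fun p => (p.2 : ℚ) * Wq (s * p.1)).sum + Wq (s * m) := by
  induction acc with
  | nil => simp [incr]
  | cons p t ih =>
    obtain ⟨m', c⟩ := p
    by_cases h : m' = m
    · subst h
      simp only [incr, if_true, List.map_cons, List.sum_cons]
      push_cast; ring
    · simp only [incr, if_neg h, List.map_cons, List.sum_cons, ih]
      ring

theorem sum_map_foldl_incr (s : ℚ) (u : List ℕ) :
    ∀ (L : List (List ℕ)) (acc : List (ℕ × ℕ)),
    ((L.foldl (fun acc' v => incr acc' (sqDistN u v)) acc).map fun p => (p.2 : ℚ) * Wq (s * p.1)).sum =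
      (acc.map fun p => (p.2 : ℚ) * Wq (s * p.1)).sum + (L.map fun v => Wq (s * sqDistN u v)).sum
  | [], acc => by simp
  | v :: t, acc => by
    rw [List.foldl_cons, sum_map_foldl_incr s u t, sum_map_incr]
    simp only [List.map_cons, List.sum_cons]
    ring

theorem hsum_eq_dsum (L : List (List ℕ)) (s : ℚ) : hsum L s = dsum L s := by
  rw [hsum, dsum]
  congr 1
  refine List.map_congr_left fun u _ => ?_
  rw [rowHist, sum_map_foldl_incr]
  simp

/-- partial sum over a BLOCK of rows `B` against all rows of `L` (lets a long certificate be
split over several declarations, each within the farm's per-declaration kernel budget). -/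
def hsumB (B L : List (List ℕ)) (s : ℚ) : ℚ :=
  (B.map fun u => ((rowHist L u).map fun p => (p.2 : ℚ) * Wq (s * p.1)).sum).sum

theorem hsum_eq_hsumB (L : List (List ℕ)) (s : ℚ) : hsum L s = hsumB L L s := rfl

theorem hsumB_append (B₁ B₂ L : List (List ℕ)) (s : ℚ) :
    hsumB (B₁ ++ B₂) L s = hsumB B₁ L s + hsumB B₂ L s := by
  simp [hsumB, List.map_append, List.sum_append]

/-- first block. -/
theorem hsumB_split (B L : List (List ℕ)) (s : ℚ) (n : ℕ) :
    hsumB B L s = hsumB (B.take n) L s + hsumB (B.drop n) L s := by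
  conv_lhs => rw [← List.take_append_drop n B]
  rw [hsumB_append]

/-- peel the next block of `n` rows off `L.drop a`. -/
theorem hsumB_drop_split (B L : List (List ℕ)) (s : ℚ) (a n : ℕ) :
    hsumB (B.drop a) L s = hsumB ((B.drop a).take n) L s + hsumB (B.drop (a + n)) L s := by
  conv_lhs => rw [← List.take_append_drop n (B.drop a)]
  rw [hsumB_append, List.drop_drop]

/-- injectivity from `Nodup` rows of the right length and `s ≠ 0`. -/
theorem config_injective {d : ℕ} {s : ℚ} (hs : 0 < s) {L : List (List ℕ)}
    (hL : ∀ r ∈ L, r.length = d) (hN : L.Nodup) : Function.Injective (config d s L) := by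
  intro i j hij
  have hrow : L.get i = L.get j := by
    apply List.ext_getElem ((hL _ (List.get_mem L i)).trans (hL _ (List.get_mem L j)).symm)
    intro k hki hkj
    have hk : k < d := (hL _ (List.get_mem L i)) ▸ hki
    have h := congrArg (fun v : EuclideanSpace ℝ (Fin d) => v ⟨k, hk⟩) hij
    simp only [config, PiLp.toLp_apply] at h
    have hs' : Real.sqrt s ≠ 0 := (Real.sqrt_pos.2 (by exact_mod_cast hs)).ne'
    have h' := mul_left_cancel₀ hs' h
    have h'' : (L.get i).getD k 0 = (L.get j).getD k 0 := by exact_mod_cast h'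
    rw [List.getD_eq_getElem _ _ hki, List.getD_eq_getElem _ _ hkj] at h''
    exact h''
  exact (List.nodup_iff_injective_get.1 hN) hrow

/-- MASTER LEMMA: a kernel-checked rational certificate `hsum L s ≤ 2b` bounds `E(N) ≤ b`. -/
theorem groundStateEnergy_le_of_cert {d : ℕ} {s : ℚ} (hs : 0 < s) {L : List (List ℕ)}
    (hL : ∀ r ∈ L, r.length = d) (hN : L.Nodup) {b : ℚ} (hb : hsum L s ≤ 2 * b) :
    groundStateEnergy lennardJones d L.length ≤ b := by
  have h1 := groundStateEnergy_lennardJones_le (config_injective hs hL hN)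
  have h2 := two_mul_interactionEnergy_config hs.le hL
  rw [hsum_eq_dsum] at hb
  have hb' : ((dsum L s : ℚ) : ℝ) ≤ 2 * b := by exact_mod_cast hb
  linarith

/-! #### site energies, separation and half-space conditions read off the rows -/

/-- the site energy of row `i`, in closed rational form. -/
theorem siteEnergy_config {d : ℕ} {s : ℚ} (hs : 0 ≤ s) {L : List (List ℕ)}
    (hL : ∀ r ∈ L, r.length = d) (i : Fin L.length) :
    siteEnergy lennardJones (config d s L) i =
      (((L.map fun v => Wq (s * sqDistN (L.get i) v)).sum : ℚ) : ℝ) := by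
  have h0 : lennardJones (dist (config d s L i) (config d s L i)) = 0 := by
    rw [dist_self, lennardJones_zero]
  unfold siteEnergy
  rw [← add_zero (Finset.sum _ _), ← h0, Finset.sum_erase_add _ _ (Finset.mem_univ i)]
  simp_rw [lennardJones_dist_config hs hL]
  rw [← sum_fin_get L (fun v => Wq (s * sqDistN (L.get i) v))]
  push_cast
  rfl

/-- row-level separation certificate: distinct rows are at squared distance `≥ δ2 / s`. -/
def SepRows (L : List (List ℕ)) (s δ2 : ℚ) : Prop :=
  ∀ u ∈ L, ∀ v ∈ L, u = v ∨ δ2 ≤ s * sqDistN u v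

instance (L : List (List ℕ)) (s δ2 : ℚ) : Decidable (SepRows L s δ2) := by
  unfold SepRows; infer_instance

theorem sep_config {d : ℕ} {s : ℚ} (hs : 0 ≤ s) {L : List (List ℕ)}
    (hL : ∀ r ∈ L, r.length = d) (hN : L.Nodup) {δ : ℝ} {δ2 : ℚ}
    (hδ2 : δ ^ 2 = (δ2 : ℝ)) (hsep : SepRows L s δ2) (j k : Fin L.length) (hjk : j ≠ k) :
    δ ≤ dist (config d s L j) (config d s L k) := by
  have hne : L.get j ≠ L.get k := fun h => hjk ((List.nodup_iff_injective_get.1 hN) h)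
  have h2 : (δ2 : ℝ) ≤ (s : ℝ) * (sqDistN (L.get j) (L.get k) : ℝ) := by
    rcases hsep _ (List.get_mem L j) _ (List.get_mem L k) with h | h
    · exact absurd h hne
    · exact_mod_cast h
  rw [← dist_sq_config hs hL] at h2
  rw [← hδ2] at h2
  by_contra hlt
  rw [not_le] at hlt
  nlinarith [dist_nonneg (x := config d s L j) (y := config d s L k)]

/-- row-level half-space certificate (direction `e₃`): every row's third coordinate is at most
that of row `i`. -/
theorem halfspace_config {s : ℚ} {L : List (List ℕ)} (i : Fin L.length)
    (hz : ∀ v ∈ L, v.getD 2 0 ≤ (L.get i).getD 2 0) (j : Fin L.length) :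
    inner ℝ (config 3 s L j - config 3 s L i) (EuclideanSpace.single (2 : Fin 3) (1 : ℝ)) ≤ 0 := by
  rw [EuclideanSpace.inner_single_right]
  simp only [one_mul, PiLp.sub_apply, config, Fin.isValue, Fin.val_two, conj_trivial]
  have h := hz _ (List.get_mem L j)
  have h' : (((L.get j).getD 2 0 : ℕ) : ℝ) ≤ ((L.get i).getD 2 0 : ℕ) := by exact_mod_cast h
  have hs0 : 0 ≤ Real.sqrt s := Real.sqrt_nonneg _
  have := mul_le_mul_of_nonneg_left h' hs0
  linarith

/-- half-space certificate in the diagonal direction `(1,1,1)` (the fcc `(111)` normal in cubic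
coordinates): every row's coordinate sum is at most that of row `i`. -/
theorem halfspace_config_diag {s : ℚ} {L : List (List ℕ)} (i : Fin L.length)
    (hz : ∀ v ∈ L, v.getD 0 0 + v.getD 1 0 + v.getD 2 0 ≤
      (L.get i).getD 0 0 + (L.get i).getD 1 0 + (L.get i).getD 2 0) (j : Fin L.length) :
    inner ℝ (config 3 s L j - config 3 s L i) (WithLp.toLp 2 fun _ : Fin 3 => (1 : ℝ)) ≤ 0 := by
  simp only [PiLp.inner_apply, PiLp.sub_apply, config, RCLike.inner_apply, conj_trivial,
    Fin.sum_univ_three, Fin.isValue, Fin.val_zero, Fin.val_one, Fin.val_two]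
  have h := hz _ (List.get_mem L j)
  have h' : (((L.get j).getD 0 0 : ℕ) : ℝ) + ((L.get j).getD 1 0 : ℕ) + ((L.get j).getD 2 0 : ℕ) ≤
      (((L.get i).getD 0 0 : ℕ) : ℝ) + ((L.get i).getD 1 0 : ℕ) + ((L.get i).getD 2 0 : ℕ) := by
    exact_mod_cast h
  have hs0 : 0 ≤ Real.sqrt s := Real.sqrt_nonneg _
  have := mul_le_mul_of_nonneg_left h' hs0
  nlinarith

/-- the fcc `(111)` half ball: even-sum rows in `[0,2r]³` with `|v - (r,r,r)|² ≤ R2` and coordinate sum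
`≤ 3r` (closed lower half-space of the diagonal), the centre `(r,r,r)` moved to the front. -/
def fccHalfBall (r R2 : ℕ) : List (List ℕ) :=
  [r, r, r] :: ((boxVecs 3 r).filter fun v =>
    decide ((v.sum + 3 * r) % 2 = 0 ∧ normSqC r v ≤ R2 ∧ v.sum ≤ 3 * r ∧ v ≠ [r, r, r]))

/-- parity lemma: a nonzero integer vector with even coordinate sum has squared norm `≥ 2`
(the `D₃ = fcc` root lattice has minimal norm `2`). -/
theorem two_le_sq_of_even (x y z : ℤ) (hpar : (x + y + z) % 2 = 0) (hne : ¬ (x = 0 ∧ y = 0 ∧ z = 0)) :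
    2 ≤ x ^ 2 + y ^ 2 + z ^ 2 := by
  by_contra hlt
  rw [not_le] at hlt
  have hx : x ^ 2 ≤ 1 := by nlinarith [sq_nonneg y, sq_nonneg z]
  have hy : y ^ 2 ≤ 1 := by nlinarith [sq_nonneg x, sq_nonneg z]
  have hz : z ^ 2 ≤ 1 := by nlinarith [sq_nonneg x, sq_nonneg y]
  have hx1 : -1 ≤ x ∧ x ≤ 1 := by constructor <;> nlinarith
  have hy1 : -1 ≤ y ∧ y ≤ 1 := by constructor <;> nlinarith
  have hz1 : -1 ≤ z ∧ z ≤ 1 := by constructor <;> nlinarith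
  obtain ⟨hxa, hxb⟩ := hx1; obtain ⟨hya, hyb⟩ := hy1; obtain ⟨hza, hzb⟩ := hz1
  interval_cases x <;> interval_cases y <;> interval_cases z <;> omega

theorem cast_sqDiffN_int (a b : ℕ) : ((sqDiffN a b : ℕ) : ℤ) = ((a : ℤ) - b) ^ 2 := by
  unfold sqDiffN
  have h : 2 * a * b ≤ a * a + b * b := by nlinarith [sq_nonneg ((a : ℤ) - b)]
  rw [Nat.cast_sub h]
  push_cast
  ring

/-- distinct rows of length 3 with coordinate sums of equal parity are at squared distance `≥ 2`. -/
theorem two_le_sqDistN {u v : List ℕ} (hu : u.length = 3) (hv : v.length = 3)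
    (hpar : u.sum % 2 = v.sum % 2) (hne : u ≠ v) : 2 ≤ sqDistN u v := by
  obtain ⟨a, b, c, rfl⟩ := List.length_eq_three.1 hu
  obtain ⟨a', b', c', rfl⟩ := List.length_eq_three.1 hv
  have hs : sqDistN [a, b, c] [a', b', c'] = sqDiffN a a' + (sqDiffN b b' + (sqDiffN c c' + 0)) := rfl
  have key := two_le_sq_of_even ((a : ℤ) - a') ((b : ℤ) - b') ((c : ℤ) - c') (by
      simp only [List.sum_cons, List.sum_nil, add_zero] at hpar
      omega) (by
      rintro ⟨h1, h2, h3⟩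
      apply hne
      have : a = a' := by omega
      have : b = b' := by omega
      have : c = c' := by omega
      subst_vars; rfl)
  have : ((sqDistN [a, b, c] [a', b', c'] : ℕ) : ℤ) =
      ((a : ℤ) - a') ^ 2 + ((b : ℤ) - b') ^ 2 + ((c : ℤ) - c') ^ 2 := by
    rw [hs]; push_cast [cast_sqDiffN_int]; ring
  omega

/-- every row of `fccHalfBall r R2` has length 3 and coordinate sum `≡ 3r (mod 2)`. -/
theorem fccHalfBall_mem {r R2 : ℕ} {v : List ℕ} (hv : v ∈ fccHalfBall r R2)
    (hlen : ∀ w ∈ fccHalfBall r R2, w.length = 3) :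
    v.length = 3 ∧ (v.sum + 3 * r) % 2 = 0 := by
  refine ⟨hlen v hv, ?_⟩
  unfold fccHalfBall at hv
  rcases List.mem_cons.1 hv with rfl | h
  · simp only [List.sum_cons, List.sum_nil, add_zero]; omega
  · rw [List.mem_filter] at h
    have := of_decide_eq_true h.2
    exact this.1

/-- hence the fcc half ball is separated at the nearest-neighbour distance `√(2s)` with NO kernel
pair loop (`SepRows` from the parity lemma). -/
theorem sepRows_fccHalfBall {r R2 : ℕ} (hlen : ∀ w ∈ fccHalfBall r R2, w.length = 3)
    (s : ℚ) (hs : 0 ≤ s) : SepRows (fccHalfBall r R2) s (2 * s) := by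
  intro u hu v hv
  by_cases huv : u = v
  · exact Or.inl huv
  · right
    obtain ⟨hul, hup⟩ := fccHalfBall_mem hu hlen
    obtain ⟨hvl, hvp⟩ := fccHalfBall_mem hv hlen
    have h2 := two_le_sqDistN hul hvl (by omega) huv
    have h2' : (2 : ℚ) ≤ (sqDistN u v : ℚ) := by exact_mod_cast h2
    nlinarith

end Cert

open Cert

/-- The `D₅` ball `{v ∈ ℤ⁵ : ∑ vᵢ even, |v|² ≤ 4}`: 131 points (origin, 40 roots, 90 of norm 2). -/
def d5Rows : List (List ℕ) := dBall 5 2 4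

set_option maxHeartbeats 8000000 in
/-- `d = 5`: `E(131) ≤ -140 < -131` in `ℝ⁵` (nearest-neighbour distance `1`, exact rational
energy `-145.708…`; kernel-decided). -/
theorem d5_energy_le : groundStateEnergy lennardJones 5 131 ≤ -(140 : ℝ) := by
  have h := groundStateEnergy_le_of_cert (d := 5) (s := 1 / 2) (by norm_num) (L := d5Rows)
    (by decide +kernel) (by decide +kernel) (b := -140) (by decide +kernel)
  have hl : d5Rows.length = 131 := by decide +kernel
  rw [hl] at h
  exact h.trans (by norm_num)

/-- ANY PROOF MUST USE `d ≤ 3` QUANTITATIVELY: the `ℝ⁵` analogue of the crux is false. -/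
theorem not_stability_dim5 : ¬ ∀ N : ℕ, -(N : ℝ) ≤ groundStateEnergy lennardJones 5 N := by
  intro h; have h1 := h 131; norm_num at h1; linarith [d5_energy_le]

/-- The `D₆` roots `±eᵢ ± eⱼ` and the origin (`|v|² ≤ 2`, even sum): 61 points of `ℤ⁶`. -/
def d6Rows : List (List ℕ) := dBall 6 1 2

set_option maxHeartbeats 2000000 in
/-- `d = 6`: `E(61) ≤ -63 < -61` (exact rational energy `-63.2199…`). In `d ≥ 6` the `r⁻⁶` tail is
not integrable, so the analogue fails for a trivial reason at large `N`; this is the small witness. -/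
theorem d6_energy_le : groundStateEnergy lennardJones 6 61 ≤ -(63 : ℝ) := by
  have h := groundStateEnergy_le_of_cert (d := 6) (s := 1 / 2) (by norm_num) (L := d6Rows)
    (by decide +kernel) (by decide +kernel) (b := -63) (by decide +kernel)
  have hl : d6Rows.length = 61 := by decide +kernel
  rw [hl] at h
  exact h.trans (by norm_num)

theorem not_stability_dim6 : ¬ ∀ N : ℕ, -(N : ℝ) ≤ groundStateEnergy lennardJones 6 N := by
  intro h; have h1 := h 61; norm_num at h1; linarith [d6_energy_le]

/-! ### §3c Monotonicity in the dimension: the analogue fails for EVERY `d ≥ 4` -/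

/-- embed `ℝᵈ ⊂ ℝ^{d+k}` by appending zero coordinates. -/
def embed (d k : ℕ) (p : EuclideanSpace ℝ (Fin d)) : EuclideanSpace ℝ (Fin (d + k)) :=
  WithLp.toLp 2 (Fin.append (WithLp.ofLp p) (0 : Fin k → ℝ))

theorem embed_sub (d k : ℕ) (p q : EuclideanSpace ℝ (Fin d)) :
    embed d k p - embed d k q = embed d k (p - q) := by
  ext j
  simp only [embed, PiLp.sub_apply, PiLp.toLp_apply]
  refine Fin.addCases (fun i => ?_) (fun i => ?_) j
  · simp [Fin.append_left]
  · simp [Fin.append_right]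

theorem norm_embed (d k : ℕ) (p : EuclideanSpace ℝ (Fin d)) : ‖embed d k p‖ = ‖p‖ := by
  rw [EuclideanSpace.norm_eq, EuclideanSpace.norm_eq]
  congr 1
  rw [Fin.sum_univ_add]
  simp [embed, Fin.append_left, Fin.append_right]

theorem dist_embed (d k : ℕ) (p q : EuclideanSpace ℝ (Fin d)) :
    dist (embed d k p) (embed d k q) = dist p q := by
  rw [dist_eq_norm, dist_eq_norm, embed_sub, norm_embed]

theorem embed_injective (d k : ℕ) : Function.Injective (embed d k) := by
  intro p q h
  have : dist (embed d k p) (embed d k q) = 0 := by rw [h, dist_self]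
  rw [dist_embed] at this
  exact dist_eq_zero.1 this

theorem interactionEnergy_embed (V : ℝ → ℝ) {d k N : ℕ} (x : Fin N → EuclideanSpace ℝ (Fin d)) :
    interactionEnergy V (fun i => embed d k (x i)) = interactionEnergy V x := by
  simp [interactionEnergy, dist_embed]

/-- MONOTONICITY IN THE DIMENSION: `E_{d+k}(N) ≤ E_d(N)` (`d ≥ 1`). -/
theorem groundStateEnergy_mono_dim {d : ℕ} (hd : 0 < d) (k N : ℕ) :
    groundStateEnergy lennardJones (d + k) N ≤ groundStateEnergy lennardJones d N := by
  haveI := nonempty_injective_config hd N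
  refine le_ciInf fun x => ?_
  have hinj : Function.Injective fun i => embed d k (x.1 i) := (embed_injective d k).comp x.2
  exact (groundStateEnergy_lennardJones_le hinj).trans_eq (interactionEnergy_embed lennardJones x.1)

/-- certified in THIS file: the `ℝᵈ` analogue of the crux is false for every `d ≥ 5` (zero-padding
the `D₅` witness); `d = 4` — the threshold case — is `not_stability_dim_ge_four` in `DisproofHeavyD4.lean`. -/
theorem not_stability_dim_ge_five {d : ℕ} (hd : 5 ≤ d) :
    ¬ ∀ N : ℕ, -(N : ℝ) ≤ groundStateEnergy lennardJones d N := by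
  obtain ⟨k, rfl⟩ := Nat.exists_eq_add_of_le hd
  intro h
  have h1 := h 131
  have h2 := groundStateEnergy_mono_dim (d := 5) (by norm_num) k 131
  norm_num at h1
  linarith [d5_energy_le]

/-! ## §4 Tightness of the constant -/

/-- The centred cuboctahedron (fcc ball `|v|² ≤ 2`, 13 points). -/
def fcc13Rows : List (List ℕ) := dBall 3 1 2

/-- `E(13) ≤ -27/8` (nearest-neighbour distance `1`; exact `-3.3953…`), so no `E(N) ≥ -c N` with
`c < 27/104 = 0.2596`. -/
theorem fcc13_energy_le : groundStateEnergy lennardJones 3 13 ≤ -(27 / 8 : ℝ) := by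
  have h := groundStateEnergy_le_of_cert (d := 3) (s := 1 / 2) (by norm_num) (L := fcc13Rows)
    (by decide +kernel) (by decide +kernel) (b := -27 / 8) (by decide +kernel)
  have hl : fcc13Rows.length = 13 := by decide +kernel
  rw [hl] at h
  exact h.trans (by norm_num)

theorem not_stabilityConstant_quarter :
    ¬ ∀ N : ℕ, -((N : ℝ) / 4) ≤ groundStateEnergy lennardJones 3 N := by
  intro h; have h1 := h 13; norm_num at h1; linarith [fcc13_energy_le]

/-- The fcc ball `|v|² ≤ 8` (55 points: the two-shell cuboctahedral cluster). -/
def fcc55Rows : List (List ℕ) := dBall 3 2 8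

set_option maxHeartbeats 2000000 in
/-- `E(55) ≤ -22.3` at nearest-neighbour distance `√0.96` (exact `-22.3233…`), so any valid
`E(N) ≥ -c N` has `c ≥ 0.4054` (gen 1 had `0.40209` at unit spacing). -/
theorem fcc55_energy_le : groundStateEnergy lennardJones 3 55 ≤ -(223 / 10 : ℝ) := by
  have h := groundStateEnergy_le_of_cert (d := 3) (s := 12 / 25) (by norm_num) (L := fcc55Rows)
    (by decide +kernel) (by decide +kernel) (b := -223 / 10) (by decide +kernel)
  have hl : fcc55Rows.length = 55 := by decide +kernel
  rw [hl] at h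
  exact h.trans (by norm_num)

theorem not_stabilityConstant_twoFifths :
    ¬ ∀ N : ℕ, -(2 * (N : ℝ) / 5) ≤ groundStateEnergy lennardJones 3 N := by
  intro h; have h1 := h 55; norm_num at h1; linarith [fcc55_energy_le]

/-- CONDITIONAL TIGHTNESS at the true scale: once the trial-state bound `CrysEnergyUpper`
(item 11865, `limsup E(N)/N ≤ ⨅ periodic e`) is proved, every periodic configuration `P` caps the
admissible constants: no `E(N) ≥ -c N` with `c < -e(P)` (fcc at spacing `0.9712`: `c ≥ 0.7175`).
Sorry-free; what is missing for an unconditional `c ≥ 0.7175` is 11865 plus a certified lattice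
sum `e(fcc) ≤ -0.7175 + 10⁻⁴` (interval arithmetic on `A₆ = 14.4539`, `A₁₂ = 12.1319`). -/
theorem tight_of_crysEnergyUpper (hU : CrysEnergyUpper)
    (hbdd : BddBelow (Set.range fun Q : PeriodicConfiguration 3 => Q.energyPerParticle lennardJones))
    (P : PeriodicConfiguration 3) {c : ℝ} (hc : c < -P.energyPerParticle lennardJones) :
    ¬ ∀ N : ℕ, -(c * (N : ℝ)) ≤ groundStateEnergy lennardJones 3 N := by
  intro h
  -- `E(N)/N ≥ -c` for `N ≥ 1`, hence `liminf ≥ -c`; with `limsup ≤ e(P) < -c` — contradiction.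
  have hle : Filter.limsup (fun N : ℕ => groundStateEnergy lennardJones 3 N / N) atTop ≤
      P.energyPerParticle lennardJones := hU.trans (ciInf_le hbdd P)
  obtain ⟨e, _, htend, _⟩ := BlancLewin2015_8_holds 3 (by norm_num) (by norm_num)
  have hlim : Filter.limsup (fun N : ℕ => groundStateEnergy lennardJones 3 N / N) atTop = e :=
    htend.limsup_eq
  have hge : -c ≤ e := by
    refine ge_of_tendsto htend ?_
    filter_upwards [eventually_gt_atTop 0] with N hN
    have hN' : (0 : ℝ) < N := by exact_mod_cast hN
    rw [le_div_iff₀ hN']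
    have := h N
    linarith
  linarith

/-! ## §5 The one-centre (sitewise) strategy and its failure under separation alone -/

/-- SITEWISE TWELVE under `δ`-separation: every particle of every `δ`-separated configuration has
site energy `∑_{k ≠ i} V_LJ ≥ -2`. With `δ = 0.684` (Yuhjtman Cor. 7, the separation PROVED for
ground states) this would imply the crux by `2E = ∑ sites` — but it is FALSE (hedgehogs), see
`not_sitewiseTwelve_0744` / `not_sitewiseTwelve_0684` below. The bulk fcc site energy is `-1.4344`
(margin `28 %` to `-2`). -/
def SitewiseTwelve (δ : ℝ) : Prop :=
  ∀ (N : ℕ) (x : Fin N → EuclideanSpace ℝ (Fin 3)),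
    (∀ i j, i ≠ j → δ ≤ dist (x i) (x j)) → ∀ i, -2 ≤ siteEnergy lennardJones x i

/-- Double counting: a sitewise bound at the separation of ground states gives the crux
(the strategy the hedgehogs kill at `δ = 0.684`; it revives only if BOTH a larger separation is
proved for ground states AND the hedgehog table says sitewise holds there). -/
theorem stabilityConstantTwelve_of_sitewise {δ : ℝ}
    (hsep : ∀ (N : ℕ) (x : Fin N → EuclideanSpace ℝ (Fin 3)), IsGroundState lennardJones x →
      ∀ i j, i ≠ j → δ ≤ dist (x i) (x j))
    (h : SitewiseTwelve δ) : StabilityConstantTwelve := by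
  intro N
  obtain ⟨x, hx⟩ := exists_isGroundState_lennardJones (d := 3) (by norm_num) N
  rw [← hx.2]
  have h2 := two_mul_interactionEnergy lennardJones x
  have hs : ∀ i, -2 ≤ siteEnergy lennardJones x i := h N x (hsep N x hx)
  have := Finset.sum_le_sum fun i (_ : i ∈ Finset.univ) => hs i
  rw [Finset.sum_const, Finset.card_univ, Fintype.card_fin, nsmul_eq_mul] at this
  linarith

/-- The separation actually available: Yuhjtman's Cor. 7 (PROVED in the tree). -/
theorem groundState_separated_0684 (N : ℕ) (x : Fin N → EuclideanSpace ℝ (Fin 3))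
    (hx : IsGroundState lennardJones x) (i j : Fin N) (hij : i ≠ j) :
    (0.684 : ℝ) ≤ dist (x i) (x j) :=
  (Yuhjtman2015_minDistance_holds N x hx i j hij).le

/-- The Kiessling–Wales conjecture (arXiv:2511.15008, 2025): in every Lennard-Jones global minimiser
all pairs are at distance `> 2^{-1/6}` (our units; `= 0.8909`, the zero of `V_LJ`), i.e. every pair term
is attractive. Numerically `d_min ≈ 0.903` (`N = 923`). Open; recorded here as a hypothesis only. -/
def KWConjecture : Prop :=
  ∀ (N : ℕ) (x : Fin N → EuclideanSpace ℝ (Fin 3)), IsGroundState lennardJones x →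
    ∀ i j, i ≠ j → (2 : ℝ) ^ (-(1 : ℝ) / 6) ≤ dist (x i) (x j)

/-- CONDITIONAL ROUTE (for planners): the KW conjecture plus a one-centre bound at separation
`2^{-1/6}` gives the crux. The second hypothesis is a bounded, computer-assisted one-centre problem
(hedgehogs reach only `≈ 19–20` of the `24` bonds needed at this separation — numerics, kit j007594);
the first is a genuinely open structural statement about minimisers. -/
theorem stabilityConstantTwelve_of_KW (hKW : KWConjecture)
    (h : SitewiseTwelve ((2 : ℝ) ^ (-(1 : ℝ) / 6))) : StabilityConstantTwelve :=
  stabilityConstantTwelve_of_sitewise hKW h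

/-- Monotonicity: a larger separation is a stronger hypothesis. -/
theorem SitewiseTwelve.mono {δ δ' : ℝ} (hle : δ ≤ δ') (h : SitewiseTwelve δ) : SitewiseTwelve δ' :=
  fun N x hx i => h N x (fun j k hjk => hle.trans (hx j k hjk)) i

/-- THE HEDGEHOG (certified witness): centre + the 24 snub-cube directions at radius `1.0000`
+ 6 axis points at radius `1.5` + 8 diagonal points at radius `1.6` (coordinates `× 10⁴`,
translated by `(2·10⁴)³`; row 0 is the centre). Pairwise distances `≥ 0.7441`, site energy of the
centre `-2.16102…` (`= -(23.99 + 1.01 + 0.93)/12`: first shell, axis, diagonal bonds). -/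
def hedgehogRows : List (List ℕ) :=
  [[20000,20000,20000],
   [22514,24623,28503],
   [24623,28503,22514],
   [28503,22514,24623],
   [24623,22514,11497],
   [22514,28503,15377],
   [28503,24623,17486],
   [24623,17486,28503],
   [22514,11497,24623],
   [28503,15377,22514],
   [22514,15377,11497],
   [24623,11497,17486],
   [28503,17486,15377],
   [15377,22514,28503],
   [17486,28503,24623],
   [11497,24623,22514],
   [17486,24623,11497],
   [15377,28503,17486],
   [11497,22514,15377],
   [17486,15377,28503],
   [15377,11497,22514],
   [11497,17486,24623],
   [15377,17486,11497],
   [17486,11497,15377],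
   [11497,15377,17486],
   [35000,20000,20000],
   [5000,20000,20000],
   [20000,35000,20000],
   [20000,5000,20000],
   [20000,20000,35000],
   [20000,20000,5000],
   [29238,29238,29238],
   [29238,29238,10762],
   [29238,10762,29238],
   [29238,10762,10762],
   [10762,29238,29238],
   [10762,29238,10762],
   [10762,10762,29238],
   [10762,10762,10762]]

theorem hedgehogRows_len : ∀ r ∈ hedgehogRows, r.length = 3 := by decide +kernel
theorem hedgehogRows_nodup : hedgehogRows.Nodup := by decide +kernel
theorem hedgehogRows_sep : SepRows hedgehogRows (1 / 10 ^ 8) ((93 / 125) ^ 2) := by decide +kernel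
theorem hedgehogRows_pos : 0 < hedgehogRows.length := by decide +kernel

/-- the centre of the hedgehog has site energy `< -2` (exact rational evaluation). -/
theorem hedgehog_siteEnergy_lt :
    siteEnergy lennardJones (config 3 (1 / 10 ^ 8) hedgehogRows) ⟨0, hedgehogRows_pos⟩ < -2 := by
  rw [siteEnergy_config (by norm_num) hedgehogRows_len]
  have h : ((hedgehogRows.map fun v =>
      Wq (1 / 10 ^ 8 * sqDistN (hedgehogRows.get ⟨0, hedgehogRows_pos⟩) v)).sum : ℚ) < -2 := by
    decide +kernel
  exact_mod_cast h

/-- ONE-CENTRE IS DEAD up to separation `0.744`: `SitewiseTwelve 0.744` is false (hedgehog), a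
fortiori `SitewiseTwelve 0.684` (the separation proved for ground states). The sitewise threshold
`δ*` (smallest separation at which no hedgehog reaches `-2`) therefore exceeds `0.744`; the kit job
j006695 (compute/hedgehog) tabulates hedgehog optima for `δ ∈ [0.684, 1]`. -/
theorem not_sitewiseTwelve_0744 : ¬ SitewiseTwelve 0.744 := by
  intro h
  have hsep := sep_config (d := 3) (s := 1 / 10 ^ 8) (by norm_num) hedgehogRows_len
    hedgehogRows_nodup (δ := 0.744) (δ2 := (93 / 125) ^ 2) (by norm_num) hedgehogRows_sep
  have := h _ (config 3 (1 / 10 ^ 8) hedgehogRows) hsep ⟨0, hedgehogRows_pos⟩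
  linarith [hedgehog_siteEnergy_lt]

theorem not_sitewiseTwelve_0684 : ¬ SitewiseTwelve 0.684 :=
  fun h => not_sitewiseTwelve_0744 (h.mono (by norm_num))

/-! ## §6 The induction-by-removal strategy: certified reduction, and why it has no slack -/

/-- Removing one particle: `E(N) ≤ 𝓔(x) - s_i(x)` for every injective `x` on `N + 1` particles
and every `i` (the remaining `N` particles form an admissible configuration). -/
theorem groundStateEnergy_le_sub_siteEnergy {d N : ℕ} {x : Fin (N + 1) → EuclideanSpace ℝ (Fin d)}
    (hx : Function.Injective x) (i : Fin (N + 1)) :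
    groundStateEnergy lennardJones d N ≤
      interactionEnergy lennardJones x - siteEnergy lennardJones x i := by
  have h := two_mul_groundStateEnergy_card_le lennardJones lennardJones_zero
    neg_one_div_le_lennardJones hx (Finset.univ.erase i)
  have hcard : (Finset.univ.erase i).card = N := by
    rw [Finset.card_erase_of_mem (Finset.mem_univ i), Finset.card_univ, Fintype.card_fin]; rfl
  rw [hcard] at h
  have h2 := two_mul_interactionEnergy_eq_sum_sum lennardJones lennardJones_zero x
  set F : Fin (N + 1) → Fin (N + 1) → ℝ := fun a b => lennardJones (dist (x a) (x b)) with hF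
  have hsymm : ∀ a b, F a b = F b a := fun a b => by simp [hF, dist_comm]
  have hdiag : F i i = 0 := by simp [hF, lennardJones_zero]
  have hsite : siteEnergy lennardJones x i = ∑ k ∈ Finset.univ.erase i, F i k := rfl
  have hrow : ∀ a, ∑ b, F a b = F a i + ∑ b ∈ Finset.univ.erase i, F a b := fun a =>
    (Finset.add_sum_erase _ _ (Finset.mem_univ i)).symm
  have htot : ∑ a, ∑ b, F a b = 2 * siteEnergy lennardJones x i +
      ∑ a ∈ Finset.univ.erase i, ∑ b ∈ Finset.univ.erase i, F a b := by
    rw [← Finset.add_sum_erase _ _ (Finset.mem_univ i), hrow i, hdiag, zero_add]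
    rw [Finset.sum_congr rfl fun a _ => hrow a, Finset.sum_add_distrib]
    rw [Finset.sum_congr rfl fun a _ => hsymm a i, ← hsite]
    ring
  have h2' : 2 * interactionEnergy lennardJones x = ∑ a, ∑ b, F a b := h2
  linarith

/-- THE INDUCTION ROUTE, certified reduction: if every Lennard-Jones ground state on `N + 1`
particles has SOME particle with site energy `≥ -1`, then `E(N+1) ≥ E(N) - 1` and the crux follows
by induction (`E(0) = 0`). In nature the weakest-bound particle (a vertex atom) has site energy
`≈ -0.6`, so the hypothesis is true with margin — but see `ExtremeSiteBound` for why it is out of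
reach of shape-free arguments. -/
theorem stabilityConstantTwelve_of_exists_weak_site
    (h : ∀ (N : ℕ) (x : Fin (N + 1) → EuclideanSpace ℝ (Fin 3)), IsGroundState lennardJones x →
      ∃ i, -1 ≤ siteEnergy lennardJones x i) : StabilityConstantTwelve := by
  intro N
  induction N with
  | zero => simp [groundStateEnergy_of_le_one lennardJones (zero_le_one)]
  | succ N ih =>
    obtain ⟨x, hx⟩ := exists_isGroundState_lennardJones (d := 3) (by norm_num) (N + 1)
    obtain ⟨i, hi⟩ := h N x hx
    have hrem := groundStateEnergy_le_sub_siteEnergy hx.1 i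
    rw [hx.2] at hrem
    push_cast
    linarith

/-- EXTREME-SITE BOUND under `δ`-separation: a particle that is extreme in some direction `e`
(all others in the closed half-space `⟪x j - x i, e⟫ ≤ 0`) has site energy `≥ -1`. This is the only
shape-free way to produce the weak particle of `stabilityConstantTwelve_of_exists_weak_site`
(an extreme point of the configuration always exists). NUMBERS: the fcc `(111)` face atom at bulk
spacing `0.9712` has half-space site energy `-0.9946` (hcp `(0001)`: `-0.9946`; `(100)`: `-0.939`;
`(110)`: `-0.842`), i.e. even for perfect crystals the slack is `0.5 %`; under `δ = 0.685`
separation the half-space hedgehog below (15 unit neighbours in the closed lower half-space + 13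
outer points) violates it: `not_extremeSiteBound_0685` / `_0684`. -/
def ExtremeSiteBound (δ : ℝ) : Prop :=
  ∀ (N : ℕ) (x : Fin N → EuclideanSpace ℝ (Fin 3)) (i : Fin N) (e : EuclideanSpace ℝ (Fin 3)),
    (∀ j k, j ≠ k → δ ≤ dist (x j) (x k)) → (∀ j, inner ℝ (x j - x i) e ≤ 0) →
    -1 ≤ siteEnergy lennardJones x i


/-- Monotonicity in the separation. -/
theorem ExtremeSiteBound.mono {δ δ' : ℝ} (hle : δ ≤ δ') (h : ExtremeSiteBound δ) :
    ExtremeSiteBound δ' :=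
  fun N x i e hx hh => h N x i e (fun j k hjk => hle.trans (hx j k hjk)) hh

/-- THE HALF-SPACE HEDGEHOG (certified witness): centre (row 0) + 8 equatorial directions
`(±12,±5,0)/13, (±5,±12,0)/13` + 6 points at latitude `-39.5°` (`r = 27/35`, `h = 7/11`,
azimuths `0°,60°,…`) + south pole + 8 equatorial points at radius `1.6` + 4 lower diagonal points
at radius `1.7` + `(0,0,-1.7)`; all in the closed lower half-space of the centre, pairwise
`≥ 0.6855` apart, centre site energy `-1.36090…`. -/
def halfHedgehogRows : List (List ℕ) :=
  [[20000,20000,20000],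
   [29230,23846,20000],
   [23846,29230,20000],
   [16154,29230,20000],
   [10770,23846,20000],
   [10770,16154,20000],
   [16154,10770,20000],
   [23846,10770,20000],
   [29230,16154,20000],
   [27714,20000,13637],
   [23857,26681,13637],
   [16143,26681,13637],
   [12286,20000,13637],
   [16143,13319,13637],
   [23857,13319,13637],
   [20000,20000,10000],
   [36000,20000,20000],
   [31314,31314,20000],
   [20000,36000,20000],
   [8686,31314,20000],
   [4000,20000,20000],
   [8686,8686,20000],
   [20000,4000,20000],
   [31314,8686,20000],
   [29815,29815,10185],
   [29815,10185,10185],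
   [10185,29815,10185],
   [10185,10185,10185],
   [20000,20000,3000]]

theorem halfHedgehogRows_len : ∀ r ∈ halfHedgehogRows, r.length = 3 := by decide +kernel
theorem halfHedgehogRows_nodup : halfHedgehogRows.Nodup := by decide +kernel
theorem halfHedgehogRows_sep : SepRows halfHedgehogRows (1 / 10 ^ 8) ((137 / 200) ^ 2) := by
  decide +kernel
theorem halfHedgehogRows_pos : 0 < halfHedgehogRows.length := by decide +kernel
theorem halfHedgehogRows_below :
    ∀ v ∈ halfHedgehogRows, v.getD 2 0 ≤ (halfHedgehogRows.get ⟨0, halfHedgehogRows_pos⟩).getD 2 0 := by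
  decide +kernel

theorem halfHedgehog_siteEnergy_lt :
    siteEnergy lennardJones (config 3 (1 / 10 ^ 8) halfHedgehogRows) ⟨0, halfHedgehogRows_pos⟩ < -1 := by
  rw [siteEnergy_config (by norm_num) halfHedgehogRows_len]
  have h : ((halfHedgehogRows.map fun v =>
      Wq (1 / 10 ^ 8 * sqDistN (halfHedgehogRows.get ⟨0, halfHedgehogRows_pos⟩) v)).sum : ℚ) < -1 := by
    decide +kernel
  exact_mod_cast h

/-- THE EXTREME-POINT INDUCTION IS DEAD at the proved separation: `ExtremeSiteBound 0.685` is
false (half-space hedgehog: the centre is extreme in direction `e₃`, is `0.685`-separated from and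
among its 28 neighbours, and has site energy `-1.36 < -1`), a fortiori `ExtremeSiteBound 0.684`. -/
theorem not_extremeSiteBound_0685 : ¬ ExtremeSiteBound 0.685 := by
  intro h
  have hsep := sep_config (d := 3) (s := 1 / 10 ^ 8) (by norm_num) halfHedgehogRows_len
    halfHedgehogRows_nodup (δ := 0.685) (δ2 := (137 / 200) ^ 2) (by norm_num) halfHedgehogRows_sep
  have hhalf := halfspace_config (s := 1 / 10 ^ 8) ⟨0, halfHedgehogRows_pos⟩ halfHedgehogRows_below
  have := h _ (config 3 (1 / 10 ^ 8) halfHedgehogRows) ⟨0, halfHedgehogRows_pos⟩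
    (EuclideanSpace.single (2 : Fin 3) (1 : ℝ)) hsep hhalf
  linarith [halfHedgehog_siteEnergy_lt]

theorem not_extremeSiteBound_0684 : ¬ ExtremeSiteBound 0.684 :=
  fun h => not_extremeSiteBound_0685 (h.mono (by norm_num))

/-! ### §6b The slack of the extreme-site bound at the TRUE separation: the fcc `(111)` face, certified -/

/-- the fcc `(111)` half ball of radius `√50` lattice units around a face atom (429 rows, centre first;
cubic coordinates translated by `(8,8,8)`, nearest-neighbour distance `√(2·59/125) = 0.97160`). -/
def fcc111Rows : List (List ℕ) := fccHalfBall 8 50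

theorem fcc111Rows_len : ∀ r ∈ fcc111Rows, r.length = 3 := by decide +kernel
set_option maxHeartbeats 40000000 in
theorem fcc111Rows_nodup : fcc111Rows.Nodup := by decide +kernel
theorem fcc111Rows_pos : 0 < fcc111Rows.length := by decide +kernel
theorem fcc111Rows_below : ∀ v ∈ fcc111Rows, v.getD 0 0 + v.getD 1 0 + v.getD 2 0 ≤
    (fcc111Rows.get ⟨0, fcc111Rows_pos⟩).getD 0 0 + (fcc111Rows.get ⟨0, fcc111Rows_pos⟩).getD 1 0 +
    (fcc111Rows.get ⟨0, fcc111Rows_pos⟩).getD 2 0 := by decide +kernel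
/-- separation with NO kernel pair loop: the parity lemma (`sepRows_fccHalfBall`). -/
theorem fcc111Rows_sep : SepRows fcc111Rows (59 / 125) (2 * (59 / 125)) :=
  sepRows_fccHalfBall fcc111Rows_len _ (by norm_num)

/-- the face atom's (truncated, hence UPPER-bounding) half-space site energy is `< -0.99`
(exact rational; the infinite half-crystal gives `-0.9946`). -/
theorem fcc111_siteEnergy_lt :
    siteEnergy lennardJones (config 3 (59 / 125) fcc111Rows) ⟨0, fcc111Rows_pos⟩ < -0.99 := by
  rw [siteEnergy_config (by norm_num) fcc111Rows_len]
  have h : ((fcc111Rows.map fun v =>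
      Wq (59 / 125 * sqDistN (fcc111Rows.get ⟨0, fcc111Rows_pos⟩) v)).sum : ℚ) < -99 / 100 := by
    decide +kernel
  have h' : ((((fcc111Rows.map fun v =>
      Wq (59 / 125 * sqDistN (fcc111Rows.get ⟨0, fcc111Rows_pos⟩) v)).sum : ℚ)) : ℝ) <
      ((-99 / 100 : ℚ) : ℝ) := by
    exact_mod_cast h
  refine h'.trans_le ?_
  norm_num

/-- THE SLACK IS BELOW `1 %` AT THE TRUE SEPARATION (certified): a `0.9715`-separated configuration
(a 429-atom piece of the fcc crystal at bulk spacing) whose centre is extreme in direction `(1,1,1)`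
and has site energy `< -0.99`. So `ExtremeSiteBound δ` at realistic `δ ≈ 0.97` — IF true at all —
holds with slack `< 0.01`, out of reach of any cell/LP certificate of Yuhjtman/Hales type; and it is
FALSE at `δ ≤ 0.685` (`not_extremeSiteBound_0685`). -/
theorem fcc111_face_certificate :
    ∃ (N : ℕ) (x : Fin N → EuclideanSpace ℝ (Fin 3)) (i : Fin N) (e : EuclideanSpace ℝ (Fin 3)),
      (∀ j k, j ≠ k → (0.9715 : ℝ) ≤ dist (x j) (x k)) ∧ (∀ j, inner ℝ (x j - x i) e ≤ 0) ∧
      siteEnergy lennardJones x i < -0.99 := by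
  refine ⟨_, config 3 (59 / 125) fcc111Rows, ⟨0, fcc111Rows_pos⟩, WithLp.toLp 2 fun _ => (1 : ℝ),
    ?_, halfspace_config_diag ⟨0, fcc111Rows_pos⟩ fcc111Rows_below, fcc111_siteEnergy_lt⟩
  intro j k hjk
  have h := sep_config (d := 3) (s := 59 / 125) (by norm_num) fcc111Rows_len fcc111Rows_nodup
    (δ := Real.sqrt (118 / 125)) (δ2 := 2 * (59 / 125)) (by
      rw [Real.sq_sqrt (by norm_num)]; push_cast; norm_num) fcc111Rows_sep j k hjk
  refine le_trans ?_ h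
  rw [Real.le_sqrt (by norm_num)] <;> norm_num

end Summit.AtomisticToContinuum.Crystallization.Cruxes.StabilityConstantTwelve.Disproof
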